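import Summits.RiemannHypothesis.RiemannHypothesis.Theses.WeilWindowFlow
import Summits.RiemannHypothesis.RiemannHypothesis.Theorems.WeilWindowFlowDiniLeakageStubRelCommutatorBound
import Summits.RiemannHypothesis.RiemannHypothesis.Theorems.WeilWindowFlowDiniLeakageCalibration
import Summits.RiemannHypothesis.RiemannHypothesis.Theorems.WeilWindowFlowWindowLipschitzStubLocalizedCut
import Summits.RiemannHypothesis.RiemannHypothesis.Theorems.WeilWindowFlowStrictUnderRH
import Summits.RiemannHypothesis.RiemannHypothesis.Theorems.WeilWindowFlowWindowLipschitz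
import Summits.RiemannHypothesis.RiemannHypothesis.Theorems.WeilWindowFlowDiniGlue
import Summits.RiemannHypothesis.RiemannHypothesis.Theorems.WeilWindowFlowWindowContinuity
import Literature.NumberTheory.LFunctions.WeilSemilocalCompactnessProofs

/-!
# Line `collar-cut-edge-mass` for crux `WeilWindowFlow.DiniLeakage` (item stmt-RiemannHypothesis-1038):
# the crux from the relative edge-mass law (Stub B♭), and the exact calibration of B♭

This file lands the COMPOSITION of the line skeleton `Cruxes/DiniLeakage/Lines/collar_cut_edge_mass.lean`
(planner-cruxplan-stmt-RiemannHypothesis-1038-collar-cut-edge-mass-0, glue sorry-free) now that its unconditional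
stub E♭ is a tree theorem (`Theorems.WeilWindowFlowDiniLeakage.stub_relCommutatorBound`, p87558): the crux
`DiniLeakage` follows from ONE statement about ONE function at ONE window, the

  **relative `L²` edge-mass law (B♭)** — on every compact window range `[b₀, A] ⊂ (0, ∞)` there is `K ≥ 0` such
  that for every slack `η > 0` there is a depth `r₀ ∈ (0,1)` with `∫_{a−r<|x|} ‖u‖² ≤ (K ε(a) + η) r / log(1/r)`
  (`0 < r ≤ r₀`) for every ground state `u` of every window `a ∈ [b₀, A]`, `ε = weilGroundEnergy`,

by cutting a ground state of the LARGER window `a + h` down to `a` (the landed localised cut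
`…WindowLipschitz.stub_localizedCut` with its landed antecedents `stub_formDomainPos`, `stub_groundStateEnergy`,
`stub_eulerLagrange`), paying with the relative commutator bound (E♭), dividing by `∫‖χu‖² ≥ 1/2` and using
antitonicity `ε(a+h) ≤ ε(a)`: `diniLeakage_of_relEdgeMassLaw`.

Then the bet B♭ is CALIBRATED exactly (the disprover's Targets T2/T2″ made unconditional by E♭):
`relEdgeMassLaw_iff_riemannHypothesis_and_absEdgeMassLaw : B♭ ↔ RiemannHypothesis ∧ (absolute L² edge-mass law)`,
where the absolute law is verbatim the hypothesis (B) of the landed `…WindowLipschitz.stub_commutatorBound` — the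
unconditional regularity bet of the sibling crux `WindowLipschitz` (item 1039, line `cut-dont-squeeze`, obtained there
from the pointwise edge law `stub_edgeLaw` by the bridge `edgeMassLaw_of_pointwise`). Directions: B♭ ⇒ crux ⇒ RH
(`riemannHypothesis_of_diniLeakage`, landed calibration); B♭ ⇒ absolute law (`η = 1`, `K·max(ε b₀, 0) + 1`, antitone);
RH ∧ absolute law ⇒ B♭ (`strictUnderRH_proof`: every bottom is positive under RH; continuity gives `min_{[b₀,A]} ε > 0`;
`K := max(K_abs, 0)/min ε`). So the line's RH-strength stub is PRECISELY "RH ∧ (item 1039's registered regularity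
stub)", neither more nor less — recorded as a theorem for the planners.

FINAL CALIBRATION (same day): the sibling crux `WindowLipschitz` is now PROVED
(`…Theorems.WeilWindowFlowWindowLipschitz.WindowLipschitz_proof`, line `borderline-barrier` composed with the spine of
`cut-dont-squeeze`, landed 2026-08-16T07:19Z), and with it the absolute edge-mass law (`absEdgeMassLaw` below, extracted
from that composition). Hence **`diniLeakage_iff_riemannHypothesis : DiniLeakage ↔ RiemannHypothesis`** and
**`relEdgeMassLaw_iff_riemannHypothesis : B♭ ↔ RiemannHypothesis`**: item 1038 and the line's bet are each EXACTLY the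
Riemann hypothesis — the crux is the summit itself. And with the landed glue `diniGlue_proof` (item 1044) and
`windowContinuity_proof` (item 1041) the route's TARGET follows suit:
**`gronwallLeakage_iff_riemannHypothesis : GronwallLeakage ↔ RiemannHypothesis`** — route WeilWindowFlow's thesis X is,
as of today, exactly the summit (its regularity content is fully proved; what remains of it is RH verbatim). (Inside this namespace the identifier
`RiemannHypothesis` denotes `Summit.RiemannHypothesis`, definitionally Mathlib's statement: `Summit.RiemannHypothesis_iff`.)
-/

set_option linter.dupNamespace false

noncomputable section

open MeasureTheory Set Filter
open scoped Topology ENNReal NNReal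

namespace Summit.RiemannHypothesis.RiemannHypothesis.Theorems.WeilWindowFlowDiniLeakage

open _root_.Literature.NumberTheory.LFunctions
open _root_.Summit.RiemannHypothesis.RiemannHypothesis.Theses

/-! ### The glue of the skeleton (sorry-free there; landed here verbatim up to names) -/

/-- **The crux body from the cut (D) and the relative commutator bound (E♭-conclusion)** (the skeleton's
`diniLeakage_of_relOneStep`): for `a ∈ [b₀, A]`, `η, δ > 0` take `K', h₀(η/2)` from (E♭) on `[b₀, A + 1]`, the width
`h := min(h₀, δ/2, 1/2)`, the big window `b := a + h`, a ground state `u` of `b`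
(`ConnesConsaniMoscovici2025_thm_3_6_holds.exists_isWeilGroundState`, PROVED) and the piecewise-linear collar cutoff
`χ(x) = max(min((b − h − |x|)/h, 1), 0)`; (D) at `(b, a)` and (E♭) give `(ε a − ε b)·½ ≤ h (K' ε b + η/2)`, and
`ε b ≤ ε a` finishes with the crux constant `2K'`. -/
theorem diniLeakage_of_cut_of_relCommutator
    (hD : ∀ (a b : ℝ) (K : ℝ≥0) (u : ℝ → ℂ) (χ : ℝ → ℝ), 0 < b → b ≤ a → IsWeilGroundState a u →
        LipschitzWith K χ → (∀ x, 0 ≤ χ x ∧ χ x ≤ 1) → (∀ x, b ≤ |x| → χ x = 0) →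
        (weilGroundEnergy b - weilGroundEnergy a) * ∫ x, ‖(χ x : ℂ) * u x‖ ^ 2 ≤
          (∫ t in Ioi (0 : ℝ), weilArchDensity t *
              ∫ x, (χ (x + t) - χ x) ^ 2 * (‖u (x + t)‖ * ‖u x‖)) +
          (∑ n ∈ weilPrimeIndex a, (ArithmeticFunction.vonMangoldt n : ℝ) / Real.sqrt n *
              ∫ x, (χ (x + Real.log n) - χ x) ^ 2 * (‖u (x + Real.log n)‖ * ‖u x‖)) +
          2 * ‖∫ t, ((1 - χ t : ℝ) : ℂ) * u t * (Real.cosh (t / 2) : ℂ)‖ ^ 2 +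
          2 * ‖∫ t, u t * (Real.cosh (t / 2) : ℂ)‖ *
              ‖∫ t, (((1 - χ t) ^ 2 : ℝ) : ℂ) * u t * (Real.cosh (t / 2) : ℂ)‖ +
          2 * ‖∫ t, u t * (Real.sinh (t / 2) : ℂ)‖ *
              ‖∫ t, (((1 - χ t) ^ 2 : ℝ) : ℂ) * u t * (Real.sinh (t / 2) : ℂ)‖)
    (hE : ∀ b₀ A : ℝ, 0 < b₀ → b₀ ≤ A → ∃ K : ℝ, 0 ≤ K ∧ ∀ η : ℝ, 0 < η → ∃ h₀ : ℝ, 0 < h₀ ∧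
        ∀ (a h : ℝ) (u : ℝ → ℂ) (χ : ℝ → ℝ), b₀ ≤ a → a ≤ A → 0 < h → h ≤ h₀ →
        IsWeilGroundState a u → (∀ x y, |χ x - χ y| ≤ |x - y| / h) → (∀ x, 0 ≤ χ x ∧ χ x ≤ 1) →
        (∀ x, |x| ≤ a - 2 * h → χ x = 1) → (∀ x, a - h ≤ |x| → χ x = 0) →
        (∫ t in Ioi (0 : ℝ), weilArchDensity t *
              ∫ x, (χ (x + t) - χ x) ^ 2 * (‖u (x + t)‖ * ‖u x‖)) +
          (∑ n ∈ weilPrimeIndex a, (ArithmeticFunction.vonMangoldt n : ℝ) / Real.sqrt n *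
              ∫ x, (χ (x + Real.log n) - χ x) ^ 2 * (‖u (x + Real.log n)‖ * ‖u x‖)) +
          2 * ‖∫ t, ((1 - χ t : ℝ) : ℂ) * u t * (Real.cosh (t / 2) : ℂ)‖ ^ 2 +
          2 * ‖∫ t, u t * (Real.cosh (t / 2) : ℂ)‖ *
              ‖∫ t, (((1 - χ t) ^ 2 : ℝ) : ℂ) * u t * (Real.cosh (t / 2) : ℂ)‖ +
          2 * ‖∫ t, u t * (Real.sinh (t / 2) : ℂ)‖ *
              ‖∫ t, (((1 - χ t) ^ 2 : ℝ) : ℂ) * u t * (Real.sinh (t / 2) : ℂ)‖ ≤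
            h * (K * weilGroundEnergy a + η) ∧
          1 / 2 ≤ ∫ x, ‖(χ x : ℂ) * u x‖ ^ 2) :
    ∀ b₀ A : ℝ, 0 < b₀ → b₀ ≤ A → ∃ K : ℝ, ∀ a : ℝ, b₀ ≤ a → a ≤ A → ∀ η δ : ℝ, 0 < η → 0 < δ →
      ∃ h : ℝ, 0 < h ∧ h < δ ∧
        weilGroundEnergy a - weilGroundEnergy (a + h) ≤ h * (K * weilGroundEnergy a + η) := by
  intro b₀ A hb₀ hb₀A
  obtain ⟨K, hK0, hK⟩ := hE b₀ (A + 1) hb₀ (by linarith)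
  refine ⟨2 * K, ?_⟩
  intro a ha haA η δ hη hδ
  obtain ⟨h₀, hh₀, hest⟩ := hK (η / 2) (by positivity)
  -- the width of the collar
  set h : ℝ := min h₀ (min (δ / 2) (1 / 2)) with hhdef
  have hh : 0 < h := lt_min hh₀ (lt_min (by positivity) (by norm_num))
  have hhh₀ : h ≤ h₀ := min_le_left _ _
  have hhδ : h < δ := by
    have h1 : h ≤ δ / 2 := (min_le_right _ _).trans (min_le_left _ _)
    linarith
  have hh1 : h ≤ 1 / 2 := (min_le_right _ _).trans (min_le_right _ _)
  refine ⟨h, hh, hhδ, ?_⟩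
  have ha0 : 0 < a := lt_of_lt_of_le hb₀ ha
  -- the big window `b = a + h` and its ground state
  set b : ℝ := a + h with hbdef
  have hab : a ≤ b := by simp only [hbdef]; linarith
  have hb0 : 0 < b := lt_of_lt_of_le ha0 hab
  have hb₀b : b₀ ≤ b := ha.trans hab
  have hbA : b ≤ A + 1 := by simp only [hbdef]; linarith
  obtain ⟨u, hu⟩ := ConnesConsaniMoscovici2025_thm_3_6_holds.exists_isWeilGroundState hb0
  -- the piecewise-linear collar cutoff of width `h` at the window `b` (vanishes on `|x| ≥ b - h = a`)
  set χ : ℝ → ℝ := fun x ↦ max (min ((b - h - |x|) / h) 1) 0 with hχdef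
  have hχ01 : ∀ x, 0 ≤ χ x ∧ χ x ≤ 1 := fun x ↦
    ⟨le_max_right _ _, max_le (min_le_right _ _) zero_le_one⟩
  have hχone : ∀ x, |x| ≤ b - 2 * h → χ x = 1 := by
    intro x hx
    have h1p : 1 ≤ (b - h - |x|) / h := by
      rw [le_div_iff₀ hh]
      linarith
    show max (min ((b - h - |x|) / h) 1) 0 = 1
    rw [min_eq_right h1p, max_eq_left (zero_le_one' ℝ)]
  have hχzero : ∀ x, b - h ≤ |x| → χ x = 0 := by
    intro x hx
    have hp : (b - h - |x|) / h ≤ 0 := by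
      rw [div_le_iff₀ hh, zero_mul]
      linarith
    show max (min ((b - h - |x|) / h) 1) 0 = 0
    exact max_eq_right ((min_le_left _ _).trans hp)
  have hχzero' : ∀ x, a ≤ |x| → χ x = 0 := fun x hx ↦
    hχzero x (by simp only [hbdef]; linarith)
  have hχlip : ∀ x y, |χ x - χ y| ≤ |x - y| / h := by
    intro x y
    calc |χ x - χ y|
        = |max (min ((b - h - |x|) / h) 1) 0 - max (min ((b - h - |y|) / h) 1) 0| := rfl
      _ ≤ |min ((b - h - |x|) / h) 1 - min ((b - h - |y|) / h) 1| := abs_max_sub_max_le_abs _ _ _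
      _ ≤ max |(b - h - |x|) / h - (b - h - |y|) / h| |(1 : ℝ) - 1| := abs_min_sub_min_le_max _ _ _ _
      _ = |(b - h - |x|) / h - (b - h - |y|) / h| := by
          rw [sub_self, abs_zero, max_eq_left (abs_nonneg _)]
      _ = |(|y| - |x|)| / h := by
          rw [show (b - h - |x|) / h - (b - h - |y|) / h = (|y| - |x|) / h by ring, abs_div,
            abs_of_pos hh]
      _ ≤ |x - y| / h := by
          rw [div_le_div_iff_of_pos_right hh, abs_sub_comm x y]
          exact abs_abs_sub_abs_le_abs_sub y x
  have hχLW : LipschitzWith (Real.toNNReal (1 / h)) χ := by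
    refine LipschitzWith.of_dist_le_mul fun x y ↦ ?_
    rw [Real.dist_eq, Real.dist_eq, Real.coe_toNNReal _ (by positivity)]
    calc |χ x - χ y| ≤ |x - y| / h := hχlip x y
      _ = 1 / h * |x - y| := by ring
  -- (D) at `(big, small) = (b, a)` and (E♭) at the window `b` with slack `η/2`
  have hcut := hD b a (Real.toNNReal (1 / h)) u χ ha0 hab hu hχLW hχ01 hχzero'
  obtain ⟨hR, hm⟩ := hest b h u χ hb₀b hbA hh hhh₀ hu hχlip hχ01 hχone hχzero
  have hba' : weilGroundEnergy b ≤ weilGroundEnergy a :=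
    _root_.Summit.RiemannHypothesis.RiemannHypothesis.Theorems.WeilWindowFlowWindowLipschitz.stub_supBound_weilGroundEnergy_anti
      ha0 hab
  have hanti : 0 ≤ weilGroundEnergy a - weilGroundEnergy b := sub_nonneg.2 hba'
  have h1 : (weilGroundEnergy a - weilGroundEnergy b) * (1 / 2) ≤
      h * (K * weilGroundEnergy b + η / 2) :=
    le_trans (mul_le_mul_of_nonneg_left hm hanti) (hcut.trans hR)
  have e1 : h * (K * weilGroundEnergy b + η / 2) = h * (K * weilGroundEnergy b) + h * η / 2 := by ring
  have h2 : K * weilGroundEnergy b ≤ K * weilGroundEnergy a := mul_le_mul_of_nonneg_left hba' hK0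
  have h3 : h * (K * weilGroundEnergy b) ≤ h * (K * weilGroundEnergy a) :=
    mul_le_mul_of_nonneg_left h2 hh.le
  have e2 : h * (2 * K * weilGroundEnergy a + η) = 2 * (h * (K * weilGroundEnergy a)) + h * η := by ring
  rw [e2]
  rw [e1] at h1
  linarith

/-! ### The crux from Stub B♭ alone -/

/-- **`DiniLeakage` from the relative `L²` edge-mass law (Stub B♭) alone** — the line `collar-cut-edge-mass` CLOSED
MODULO ITS BET: the localised cut (D) is the landed `…WindowLipschitz.stub_localizedCut` fed with the landed (C1)
`stub_formDomainPos`, (C2) `stub_groundStateEnergy`, (EL) `stub_eulerLagrange C1 C2`; the relative commutator bound is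
the landed `stub_relCommutatorBound` (E♭) applied to B♭; `diniLeakage_of_cut_of_relCommutator` is the glue.
(Registered sub-goal `diniLeakage_of_relEdgeMassLaw` of item 1038, stated verbatim.) -/
theorem diniLeakage_of_relEdgeMassLaw :
    (∀ b₀ A : ℝ, 0 < b₀ → b₀ ≤ A → ∃ K : ℝ, 0 ≤ K ∧ ∀ η : ℝ, 0 < η → ∃ r₀ : ℝ, 0 < r₀ ∧ r₀ < 1 ∧ ∀ (a r : ℝ) (u : ℝ → ℂ), b₀ ≤ a → a ≤ A → IsWeilGroundState a u → 0 < r → r ≤ r₀ → ∫ x in {x : ℝ | a - r < |x|}, ‖u x‖ ^ 2 ≤ (K * weilGroundEnergy a + η) * r / Real.log (1 / r)) → Summit.RiemannHypothesis.RiemannHypothesis.Theses.WeilWindowFlow.DiniLeakage := by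
  intro hB
  have hC1 := _root_.Summit.RiemannHypothesis.RiemannHypothesis.Theorems.WeilWindowFlowWindowLipschitz.stub_formDomainPos
  have hC2 := _root_.Summit.RiemannHypothesis.RiemannHypothesis.Theorems.WeilWindowFlowWindowLipschitz.stub_groundStateEnergy
  have hEL :=
    _root_.Summit.RiemannHypothesis.RiemannHypothesis.Theorems.WeilWindowFlowWindowLipschitz.stub_eulerLagrange hC1 hC2
  have hD :=
    _root_.Summit.RiemannHypothesis.RiemannHypothesis.Theorems.WeilWindowFlowWindowLipschitz.stub_localizedCut hC1 hC2 hEL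
  exact diniLeakage_of_cut_of_relCommutator hD (stub_relCommutatorBound hB)

/-- Hence **B♭ alone proves the Riemann hypothesis** (through the crux and the landed calibration
`riemannHypothesis_of_diniLeakage`): the bet of the line is at least summit-strength, unconditionally (the disprover's
Target T2″ needed a Hopf-type edge lemma; E♭ removes it). -/
theorem riemannHypothesis_of_relEdgeMassLaw
    (hB : ∀ b₀ A : ℝ, 0 < b₀ → b₀ ≤ A → ∃ K : ℝ, 0 ≤ K ∧ ∀ η : ℝ, 0 < η → ∃ r₀ : ℝ, 0 < r₀ ∧ r₀ < 1 ∧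
      ∀ (a r : ℝ) (u : ℝ → ℂ), b₀ ≤ a → a ≤ A → IsWeilGroundState a u → 0 < r → r ≤ r₀ →
        ∫ x in {x : ℝ | a - r < |x|}, ‖u x‖ ^ 2 ≤
          (K * weilGroundEnergy a + η) * r / Real.log (1 / r)) :
    RiemannHypothesis :=
  riemannHypothesis_of_diniLeakage (diniLeakage_of_relEdgeMassLaw hB)

/-! ### The exact calibration of Stub B♭ -/

/-- **B♭ contains the ABSOLUTE `L²` edge-mass law** on the same range (take `η = 1` and
`K_abs := K · max(ε b₀, 0) + 1`, using `ε a ≤ ε b₀`, antitone): the conclusion is verbatim hypothesis (B) of the landed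
`…WindowLipschitz.stub_commutatorBound`, i.e. the unconditional regularity bet of item 1039's line `cut-dont-squeeze`. -/
theorem absEdgeMassLaw_of_relEdgeMassLaw
    (hB : ∀ b₀ A : ℝ, 0 < b₀ → b₀ ≤ A → ∃ K : ℝ, 0 ≤ K ∧ ∀ η : ℝ, 0 < η → ∃ r₀ : ℝ, 0 < r₀ ∧ r₀ < 1 ∧
      ∀ (a r : ℝ) (u : ℝ → ℂ), b₀ ≤ a → a ≤ A → IsWeilGroundState a u → 0 < r → r ≤ r₀ →
        ∫ x in {x : ℝ | a - r < |x|}, ‖u x‖ ^ 2 ≤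
          (K * weilGroundEnergy a + η) * r / Real.log (1 / r)) :
    ∀ b₀ A : ℝ, 0 < b₀ → b₀ ≤ A → ∃ K d₀ : ℝ, 0 < d₀ ∧ d₀ < 1 ∧
      ∀ (a r : ℝ) (u : ℝ → ℂ), b₀ ≤ a → a ≤ A → IsWeilGroundState a u → 0 < r → r ≤ d₀ →
        ∫ x in {x : ℝ | a - r < |x|}, ‖u x‖ ^ 2 ≤ K * r / Real.log (1 / r) := by
  intro b₀ A hb₀ hb₀A
  obtain ⟨K, hK0, hK⟩ := hB b₀ A hb₀ hb₀A
  obtain ⟨r₀, hr₀, hr₀1, hB1⟩ := hK 1 one_pos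
  refine ⟨K * max (weilGroundEnergy b₀) 0 + 1, r₀, hr₀, hr₀1, ?_⟩
  intro a r u ha haA hu hr hrd
  have hr1 : r < 1 := lt_of_le_of_lt hrd hr₀1
  have hlogr : 0 < Real.log (1 / r) := by
    apply Real.log_pos
    rw [lt_div_iff₀ hr, one_mul]
    exact hr1
  have h1 := hB1 a r u ha haA hu hr hrd
  have h2 : K * weilGroundEnergy a + 1 ≤ K * max (weilGroundEnergy b₀) 0 + 1 := by
    have e : weilGroundEnergy a ≤ max (weilGroundEnergy b₀) 0 :=
      (_root_.Summit.RiemannHypothesis.RiemannHypothesis.Theorems.WeilWindowFlowWindowLipschitz.stub_supBound_weilGroundEnergy_anti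
        hb₀ ha).trans (le_max_left _ _)
    linarith [mul_le_mul_of_nonneg_left e hK0]
  have h3 : (K * weilGroundEnergy a + 1) * r / Real.log (1 / r) ≤
      (K * max (weilGroundEnergy b₀) 0 + 1) * r / Real.log (1 / r) := by
    apply div_le_div_of_nonneg_right _ hlogr.le
    exact mul_le_mul_of_nonneg_right h2 hr.le
  exact h1.trans h3

/-- **RH ∧ (absolute edge-mass law) ⟹ B♭.** Under RH every bottom is strictly positive (`strictUnderRH_proof`, item
1043, PROVED) and `ε` is continuous (`continuousOn_weilGroundEnergy_Icc`, PROVED), so `m := min_{[b₀,A]} ε > 0` and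
`K := max(K_abs, 0)/m` serves every `η` (the disprover's `relEdgeMassLawOn_of_rh_of_abs`, def-free). -/
theorem relEdgeMassLaw_of_riemannHypothesis_of_absEdgeMassLaw (hRH : RiemannHypothesis)
    (hAbs : ∀ b₀ A : ℝ, 0 < b₀ → b₀ ≤ A → ∃ K d₀ : ℝ, 0 < d₀ ∧ d₀ < 1 ∧
      ∀ (a r : ℝ) (u : ℝ → ℂ), b₀ ≤ a → a ≤ A → IsWeilGroundState a u → 0 < r → r ≤ d₀ →
        ∫ x in {x : ℝ | a - r < |x|}, ‖u x‖ ^ 2 ≤ K * r / Real.log (1 / r)) :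
    ∀ b₀ A : ℝ, 0 < b₀ → b₀ ≤ A → ∃ K : ℝ, 0 ≤ K ∧ ∀ η : ℝ, 0 < η → ∃ r₀ : ℝ, 0 < r₀ ∧ r₀ < 1 ∧
      ∀ (a r : ℝ) (u : ℝ → ℂ), b₀ ≤ a → a ≤ A → IsWeilGroundState a u → 0 < r → r ≤ r₀ →
        ∫ x in {x : ℝ | a - r < |x|}, ‖u x‖ ^ 2 ≤
          (K * weilGroundEnergy a + η) * r / Real.log (1 / r) := by
  intro b₀ A hb₀ hA
  obtain ⟨K, d₀, hd₀, hd₀1, hK⟩ := hAbs b₀ A hb₀ hA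
  have hpos : ∀ a : ℝ, 0 < a → 0 < weilGroundEnergy a :=
    _root_.Summit.RiemannHypothesis.RiemannHypothesis.Theorems.strictUnderRH_proof
      (_root_.Summit.RiemannHypothesis_iff.2 hRH)
  obtain ⟨a₀, ha₀, hmin⟩ := (isCompact_Icc (a := b₀) (b := A)).exists_isMinOn
    (nonempty_Icc.2 hA) (continuousOn_weilGroundEnergy_Icc hb₀)
  have hm : 0 < weilGroundEnergy a₀ := hpos a₀ (lt_of_lt_of_le hb₀ ha₀.1)
  refine ⟨max K 0 / weilGroundEnergy a₀, by positivity, fun η hη ↦ ⟨d₀, hd₀, hd₀1, ?_⟩⟩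
  intro a r u ha haA hu hr hrd
  refine (hK a r u ha haA hu hr hrd).trans ?_
  have hlog : 0 < Real.log (1 / r) :=
    Real.log_pos (by rw [lt_div_iff₀ hr, one_mul]; exact lt_of_le_of_lt hrd hd₀1)
  apply div_le_div_of_nonneg_right _ hlog.le
  apply mul_le_mul_of_nonneg_right _ hr.le
  have h1 : weilGroundEnergy a₀ ≤ weilGroundEnergy a := hmin ⟨ha, haA⟩
  have h2 : 0 ≤ max K 0 / weilGroundEnergy a₀ := by positivity
  calc K ≤ max K 0 := le_max_left _ _
    _ = max K 0 / weilGroundEnergy a₀ * weilGroundEnergy a₀ := by field_simp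
    _ ≤ max K 0 / weilGroundEnergy a₀ * weilGroundEnergy a := by gcongr
    _ ≤ max K 0 / weilGroundEnergy a₀ * weilGroundEnergy a + η := by linarith

/-- **EXACT CALIBRATION OF THE BET: `B♭ ↔ RiemannHypothesis ∧ (absolute L² edge-mass law)`.** The line's only
RH-strength stub is precisely the conjunction of the summit and the unconditional regularity bet (B) of item 1039's
line `cut-dont-squeeze` (hypothesis (B) of the landed `…WindowLipschitz.stub_commutatorBound`). -/
theorem relEdgeMassLaw_iff_riemannHypothesis_and_absEdgeMassLaw :
    (∀ b₀ A : ℝ, 0 < b₀ → b₀ ≤ A → ∃ K : ℝ, 0 ≤ K ∧ ∀ η : ℝ, 0 < η → ∃ r₀ : ℝ, 0 < r₀ ∧ r₀ < 1 ∧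
      ∀ (a r : ℝ) (u : ℝ → ℂ), b₀ ≤ a → a ≤ A → IsWeilGroundState a u → 0 < r → r ≤ r₀ →
        ∫ x in {x : ℝ | a - r < |x|}, ‖u x‖ ^ 2 ≤
          (K * weilGroundEnergy a + η) * r / Real.log (1 / r)) ↔
    RiemannHypothesis ∧
      ∀ b₀ A : ℝ, 0 < b₀ → b₀ ≤ A → ∃ K d₀ : ℝ, 0 < d₀ ∧ d₀ < 1 ∧
        ∀ (a r : ℝ) (u : ℝ → ℂ), b₀ ≤ a → a ≤ A → IsWeilGroundState a u → 0 < r → r ≤ d₀ →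
          ∫ x in {x : ℝ | a - r < |x|}, ‖u x‖ ^ 2 ≤ K * r / Real.log (1 / r) :=
  ⟨fun hB ↦ ⟨riemannHypothesis_of_relEdgeMassLaw hB, absEdgeMassLaw_of_relEdgeMassLaw hB⟩,
    fun h ↦ relEdgeMassLaw_of_riemannHypothesis_of_absEdgeMassLaw h.1 h.2⟩

/-! ### Final calibration: with `WindowLipschitz` proved, the crux and the bet are each exactly RH -/

/-- **The absolute `L²` edge-mass law of Weil ground states is a THEOREM** (item 1039's Stub B): on every compact
window range `[b₀, A] ⊂ (0, ∞)` there are `K, d₀` with `∫_{a−r<|x|} ‖u‖² ≤ K r / log(1/r)` for `0 < r ≤ d₀`, every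
ground state `u` of every window `a ∈ [b₀, A]`. Extracted from the landed composition of
`…WeilWindowFlowWindowLipschitz.WindowLipschitz_proof`: pointwise edge law `stub_comparison` (two-scale barrier
`stub_barrierEnergy` + weak surplus `windowLipschitz_weakSurplus (windowLipschitz_surplus stub_surplusReduction
stub_surplusCalculus) stub_barrierWeakForm`) and the bridge `windowLipschitz_edgeMassLaw_of_pointwise`. -/
theorem absEdgeMassLaw :
    ∀ b₀ A : ℝ, 0 < b₀ → b₀ ≤ A → ∃ K d₀ : ℝ, 0 < d₀ ∧ d₀ < 1 ∧
      ∀ (a r : ℝ) (u : ℝ → ℂ), b₀ ≤ a → a ≤ A → IsWeilGroundState a u → 0 < r → r ≤ d₀ →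
        ∫ x in {x : ℝ | a - r < |x|}, ‖u x‖ ^ 2 ≤ K * r / Real.log (1 / r) := by
  have hS := _root_.Summit.RiemannHypothesis.RiemannHypothesis.Theorems.WeilWindowFlowWindowLipschitz.windowLipschitz_surplus
    _root_.Summit.RiemannHypothesis.RiemannHypothesis.Theorems.WeilWindowFlowWindowLipschitz.stub_surplusReduction
    _root_.Summit.RiemannHypothesis.RiemannHypothesis.Theorems.WeilWindowFlowWindowLipschitz.stub_surplusCalculus
  have hW := _root_.Summit.RiemannHypothesis.RiemannHypothesis.Theorems.WeilWindowFlowWindowLipschitz.windowLipschitz_weakSurplus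
    hS _root_.Summit.RiemannHypothesis.RiemannHypothesis.Theorems.WeilWindowFlowWindowLipschitz.stub_barrierWeakForm
  have hP := _root_.Summit.RiemannHypothesis.RiemannHypothesis.Theorems.WeilWindowFlowWindowLipschitz.stub_comparison
    _root_.Summit.RiemannHypothesis.RiemannHypothesis.Theorems.WeilWindowFlowWindowLipschitz.stub_barrierEnergy hW
  exact _root_.Summit.RiemannHypothesis.RiemannHypothesis.Theorems.WeilWindowFlowWindowLipschitz.windowLipschitz_edgeMassLaw_of_pointwise
    hP

/-- **THE CRUX IS EXACTLY THE RIEMANN HYPOTHESIS: `DiniLeakage ↔ RiemannHypothesis`** (the landed calibration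
`diniLeakage_iff_riemannHypothesis_and_windowLipschitz` and the landed `WindowLipschitz_proof` of item 1039).
Item stmt-RiemannHypothesis-1038 is the summit itself, not a sub-goal of it. (Registered sub-goal, stated verbatim;
`RiemannHypothesis` here denotes `Summit.RiemannHypothesis`, definitionally Mathlib's statement.) -/
theorem diniLeakage_iff_riemannHypothesis :
    Summit.RiemannHypothesis.RiemannHypothesis.Theses.WeilWindowFlow.DiniLeakage ↔ RiemannHypothesis := by
  rw [diniLeakage_iff_riemannHypothesis_and_windowLipschitz]
  exact ⟨fun h ↦ h.1, fun h ↦ ⟨h,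
    _root_.Summit.RiemannHypothesis.RiemannHypothesis.Theorems.WeilWindowFlowWindowLipschitz.WindowLipschitz_proof⟩⟩

/-- Mathlib-level spelling of `diniLeakage_iff_riemannHypothesis`. -/
theorem diniLeakage_iff_mathlib_riemannHypothesis :
    Summit.RiemannHypothesis.RiemannHypothesis.Theses.WeilWindowFlow.DiniLeakage ↔ _root_.RiemannHypothesis :=
  diniLeakage_iff_riemannHypothesis.trans _root_.Summit.RiemannHypothesis_iff

/-- **THE LINE'S BET IS EXACTLY THE RIEMANN HYPOTHESIS: `B♭ ↔ RiemannHypothesis`** (relative `L²` edge-mass law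
of ground states, Stub `stub_relEdgeMassLaw` of line `collar-cut-edge-mass`): `→` through the crux
(`riemannHypothesis_of_relEdgeMassLaw`), `←` by `relEdgeMassLaw_of_riemannHypothesis_of_absEdgeMassLaw` and the theorem
`absEdgeMassLaw`. -/
theorem relEdgeMassLaw_iff_riemannHypothesis :
    (∀ b₀ A : ℝ, 0 < b₀ → b₀ ≤ A → ∃ K : ℝ, 0 ≤ K ∧ ∀ η : ℝ, 0 < η → ∃ r₀ : ℝ, 0 < r₀ ∧ r₀ < 1 ∧
      ∀ (a r : ℝ) (u : ℝ → ℂ), b₀ ≤ a → a ≤ A → IsWeilGroundState a u → 0 < r → r ≤ r₀ →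
        ∫ x in {x : ℝ | a - r < |x|}, ‖u x‖ ^ 2 ≤
          (K * weilGroundEnergy a + η) * r / Real.log (1 / r)) ↔
    RiemannHypothesis :=
  ⟨riemannHypothesis_of_relEdgeMassLaw,
    fun h ↦ relEdgeMassLaw_of_riemannHypothesis_of_absEdgeMassLaw h absEdgeMassLaw⟩

/-- **THE ROUTE'S TARGET IS EXACTLY THE RIEMANN HYPOTHESIS: `GronwallLeakage ↔ RiemannHypothesis`** (item 1037, the
thesis X of route WeilWindowFlow): `→` is the route's deciding theorem `WeilWindowFlow.closes`; `←` is the landed glue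
`diniGlue_proof : DiniLeakage → WindowContinuity → GronwallLeakage` (item 1044) fed with
`diniLeakage_iff_riemannHypothesis` and the landed `windowContinuity_proof` (item 1041). -/
theorem gronwallLeakage_iff_riemannHypothesis :
    Summit.RiemannHypothesis.RiemannHypothesis.Theses.WeilWindowFlow.GronwallLeakage ↔ RiemannHypothesis :=
  ⟨fun h ↦ WeilWindowFlow.closes h,
    fun h ↦ _root_.Summit.RiemannHypothesis.RiemannHypothesis.Theorems.WeilWindowFlowDiniGlue.diniGlue_proof
      (diniLeakage_iff_riemannHypothesis.2 h)
      _root_.Summit.RiemannHypothesis.RiemannHypothesis.Theorems.windowContinuity_proof⟩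

end Summit.RiemannHypothesis.RiemannHypothesis.Theorems.WeilWindowFlowDiniLeakage

end
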